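import Summits.HodgeConjecture.HodgeConjecture.Theorems.F0P3SchurLineAtPin
import Summits.HodgeConjecture.HodgeConjecture.Theorems.H413CohFormsCarriers
import HarnessLib

/-!
# FLOOR-0 P3 «U3-mult», line `F0_U3CohMultOne` — the FOLDS of the registered stubs S3 (holomorphic line) and S4 (antiholomorphic
# line) from a junction carrier, Schur discharged at the pin

Cell hodgecm-mathlib, FLOOR 0; crux item H413 = stmt-HodgeConjecture-24833; line `Cruxes/H413/Lines/F0_U3CohMultOne.lean` v1.1
(cf02d7697f46cc99, F0P3-plan (g0)), registered stubs `stub_S3_holLineAt : StubS3HolLineAt` and `stub_S4_antiholLineAt : StubS4AntiholLineAt`;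
seat F0P3-p03 (JOIN-BRIEF §3 p03 «S3/S4 folds»).  THEOREMS ONLY (no definition, no named fact, no `sorry`, no new stub, no edit of the
Lines file); nothing of [Liu2021] ∕ [Rogawski1990] is asserted; HC_CM is proved only modulo the printed citations until rung 0 closes.

WHAT S3 ∕ S4 SAY.  For every face `(hDel, F, V, a₀, Φ, i)` with `3 ≤ n` and every admissible weight-one triple `t` of the printed datum
`P = datum413 hDel F V a₀ Φ i`, the `U(V)(𝔸_{F⁺,f})`-equivariant `ℂ`-linear maps `ψ : ω_V(t) → (U(V)(𝔸_{F⁺}) → ℂ²)` (`P.rhoAt t` versus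
`rightRep F V`, ★ `Theorems/H413CohFormsCarriers`) with values in `A = holCotForms 𝔞₀` (S3) resp. `A = (holCotForms 𝔞₀).map conjFun` (S4),
`𝔞₀ = archFactorOf F V`, lie on ONE LINE: `∃ ψ₀, ∀ ψ, … → ∃ r, ψ = r • ψ₀`.

WHAT THIS FILE PROVES (sorry-free, unconditional).  S3 and S4 — their types restated BINDER FOR BINDER from the Lines file ll. 201–210 ∕
217–226 (the Lines module itself is not importable on the farm) — FOLLOW from a JUNCTION CARRIER for `A`, in any of three socket shapes
(hypotheses `hJ`; the carrier is what the junction T7 «`A ↪ ⨁_Π H^{p}-line ⊗ Π_f` over the discrete `Π` of Hodge type `p`»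
[BorelWallach2000, VII 3.2] together with the engine letter E1′ «at most one such `Π` has `Π_f ≅ σ`, `m(Π) ≤ 1`» [Rogawski1990, Thm. 14.6.4,
§15.3 ¶1] (F0-typ1's `Rogawski1990/CohomologicalSpectrumInnerForm.cohFinComponentUnique_hol ∕ _antihol`) produce):
* RANK socket `stubS3_of_rankCarrier` ∕ `stubS4_of_rankCarrier`: an equivariant injection `j : τ → X` whose range contains the values of
  every equivariant `A`-valued `ψ` out of `ω_V(t)`, with `rank_ℂ Hom_{G_f}(ω_V(t), τ) ≤ 1`;
* MATSUSHIMA socket `stubS3_of_directSumCarrier` ∕ `stubS4_of_directSumCarrier`: the same `j` out of a `τ` that is `G_f`-equivariantly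
  `≅ ⨁ i, σ i` with the `σ i` irreducible-or-zero and PAIRWISE NON-ISOMORPHIC (no admissibility asked of the summands) — the rank bound is
  then SUPPLIED here by Schur at the pin (★ `F0P3SchurLineAtPin.rank_intertwiningMap_rhoAt_datum413_le_one_of_directSum`: `ω_V(t)` is
  irreducible-or-zero and admissible by [Liu2021, Def. 4.11] = ★ `Theorems.H411_proof`, and [Bump1997, Prop. 4.2.4]);
* IRREDUCIBLE socket `stubS3_of_irreducibleCarrier` ∕ `stubS4_of_irreducibleCarrier`: the same `j` out of ONE irreducible-or-zero `τ` (the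
  shape after E1′ has collapsed the sum: the `p`-part of the unique `Π` with `Π_f ≅ ω_V(t)`), rank bound again supplied by Schur at the pin.
The by-name closers `stub_S3_holLineAt := stubS3_of_…Carrier hJ` ∕ `stub_S4_antiholLineAt := stubS4_of_…Carrier hJ` typecheck against the
registered `StubS3HolLineAt` ∕ `StubS4AntiholLineAt` by `δ`-unfolding once the junction supplies `hJ`.

## References
* [Liu2021] Y. Liu, Camb. J. Math. 9 (2021) — proof of Prop. 4.13, ll. 2131–2146 (Matsushima + «`m_disc = 1`» + «`π_∞` determined by
  `π_f`»); Def. 4.11.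
* [Rogawski1990] J. Rogawski, Ann. of Math. Stud. 123 (1990) — Thm. 14.6.4, (14.6.2), §15.3 ¶1 (the engine behind the carrier).
* [BorelWallach2000] A. Borel, N. Wallach, 2nd ed. (2000) — VII 3.2, 3.6 (Matsushima; Hodge types).
* [Bump1997] D. Bump, CUP 1997 — Prop. 4.2.4 (Schur's lemma, admissible case).
* [Marshall2014] S. Marshall, Compositio 150 (2014) — §4.1 (the junction in print).
* Tree: ★ `Theorems/F0P3SchurLine.lean`, ★ `Theorems/F0P3SchurLineAtPin.lean`, ★ `Theorems/H413CohFormsCarriers.lean` (`rightRep`,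
  `holCotForms`, `conjFun`, `archFactorOf`, `adelicDatum`), ★ `CorCM/Hyp413/A3Liu413FaceTypes.lean` (`datum413`).
-/

set_option autoImplicit false

-- the mandated namespace has the single-problem summit's repeated segment (`HodgeConjecture.HodgeConjecture`)
set_option linter.dupNamespace false

noncomputable section

namespace Summit.HodgeConjecture.HodgeConjecture.Cruxes.H413.F0P3HolLineFolds

open scoped DirectSum
open NumberField
open HodgeCM.Model HodgeCM.Model.LiuIndex
open Literature.AlgebraicGeometry.Motives (CMType)
open Literature.NumberTheory.Automorphic.Liu2021
open Summit.HodgeConjecture.CorCM.Lines.A3Liu413 (datum413)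
open Summit.HodgeConjecture.HodgeConjecture.Cruxes.H413.CohFormsCarriers
open Summit.HodgeConjecture.HodgeConjecture.Cruxes.H413.F0P3SchurLine
open Summit.HodgeConjecture.HodgeConjecture.Cruxes.H413.F0P3SchurLineAtPin

universe uY uH uι uS

/-! ## §1 The master folds at an arbitrary family of carriers `A(F, V) ≤ (U(V)(𝔸_{F⁺}) → ℂ²)` -/

set_option synthInstance.maxHeartbeats 400000 in
set_option maxHeartbeats 8000000 in
/-- **MASTER FOLD, RANK socket.**  For any family of target submodules `A(F, V)` of the `ℂ²`-valued functions on `U(V)(𝔸_{F⁺})`: if at every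
face with `3 ≤ n` and every admissible weight-one `t` the equivariant `A`-valued maps out of `ω_V(t)` take values in the range of an
equivariant injection `j : τ → X` with `rank_ℂ Hom_{G_f}(ω_V(t), τ) ≤ 1`, then they lie on one line (★ `F0P3SchurLine.exists_line_of_rank_intertwiningMap_le_one`).
[cite: Liu2021, proof of Prop. 4.13, l. 2131–2146] -/
theorem line_of_rankCarrier
    (A : ∀ (F : HodgeCM.CMField) {ι₁ : F →+* ℂ} (V : HodgeCM.HermSpace3 F ι₁), Submodule ℂ ((adelicDatum F V).Adelic → (Fin 2 → ℂ)))
    (hJ : ∀ (hDel : Literature.AlgebraicGeometry.ShimuraVarieties.UnitaryCanonicalModel.canonicalModel_exists_printed)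
      (F : HodgeCM.CMField) [IsGalois ℚ F] (h6 : 6 ≤ Module.finrank ℚ F) {ι₁ : F →+* ℂ} (V : HodgeCM.HermSpace3 F ι₁) (a₀ : RealScalar F)
      (Φ : CMType F) (hΦ : ι₁ ∈ Φ.1) (i : (I V (repAt a₀) (muLiu ι₁ GramClass.rep))),
      3 ≤ (datum413 hDel F V a₀ Φ i).n → ∀ t : (datum413 hDel F V a₀ Φ i).AdmTriple,
        ∃ (Y : Type uY) (_ : AddCommGroup Y) (_ : Module ℂ Y) (τ : Representation ℂ ↥(HodgeCM.HermSpace3.adelicFin V) Y)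
          (j : Y →ₗ[ℂ] ((adelicDatum F V).Adelic → (Fin 2 → ℂ))),
          Function.Injective j ∧ (∀ (g : ↥(HodgeCM.HermSpace3.adelicFin V)) (y : Y), j (τ g y) = rightRep F V g (j y)) ∧
            (∀ ψ : (datum413 hDel F V a₀ Φ i).omegaAt t →ₗ[ℂ] ((adelicDatum F V).Adelic → (Fin 2 → ℂ)),
              (∀ (g : ↥(HodgeCM.HermSpace3.adelicFin V)) (w : (datum413 hDel F V a₀ Φ i).omegaAt t),
                  ψ ((datum413 hDel F V a₀ Φ i).rhoAt t g w) = rightRep F V g (ψ w)) →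
                (∀ w, ψ w ∈ A F V) → ∀ w, ψ w ∈ LinearMap.range j) ∧
            Module.rank ℂ (((datum413 hDel F V a₀ Φ i).rhoAt t).IntertwiningMap τ) ≤ 1) :
    ∀ (hDel : Literature.AlgebraicGeometry.ShimuraVarieties.UnitaryCanonicalModel.canonicalModel_exists_printed)
      (F : HodgeCM.CMField) [IsGalois ℚ F] (h6 : 6 ≤ Module.finrank ℚ F) {ι₁ : F →+* ℂ} (V : HodgeCM.HermSpace3 F ι₁) (a₀ : RealScalar F)
      (Φ : CMType F) (hΦ : ι₁ ∈ Φ.1) (i : (I V (repAt a₀) (muLiu ι₁ GramClass.rep))),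
      3 ≤ (datum413 hDel F V a₀ Φ i).n → ∀ t : (datum413 hDel F V a₀ Φ i).AdmTriple,
        ∃ ψ₀ : (datum413 hDel F V a₀ Φ i).omegaAt t →ₗ[ℂ] ((adelicDatum F V).Adelic → (Fin 2 → ℂ)),
          ∀ ψ : (datum413 hDel F V a₀ Φ i).omegaAt t →ₗ[ℂ] ((adelicDatum F V).Adelic → (Fin 2 → ℂ)),
            (∀ (g : ↥(HodgeCM.HermSpace3.adelicFin V)) (w : (datum413 hDel F V a₀ Φ i).omegaAt t),
                ψ ((datum413 hDel F V a₀ Φ i).rhoAt t g w) = rightRep F V g (ψ w)) →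
              (∀ w, ψ w ∈ A F V) → ∃ r : ℂ, ψ = r • ψ₀ := by
  intro hDel F _ h6 ι₁ V a₀ Φ hΦ i hn t
  obtain ⟨Y, _, _, τ, j, hj, hjeqv, hA, hrank⟩ := hJ hDel F h6 V a₀ Φ hΦ i hn t
  exact exists_line_rhoAt_datum413_of_rank_carrier hDel F V a₀ Φ i t (rightRep F V) (A F V) τ j hj hjeqv hA hrank

set_option synthInstance.maxHeartbeats 400000 in
set_option maxHeartbeats 8000000 in
/-- **MASTER FOLD, MATSUSHIMA (direct-sum) socket** — the carrier `τ` is `G_f`-equivariantly `≅ ⨁ i, σ i` with the `σ i` irreducible-or-zero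
and pairwise non-isomorphic; the rank bound is supplied by Schur at the pin (★ `rank_intertwiningMap_rhoAt_datum413_le_one_of_directSum`).
[cite: BorelWallach2000, VII 3.2] [cite: Bump1997, Proposition 4.2.4] [cite: Liu2021, proof of Prop. 4.13, l. 2131–2146] -/
theorem line_of_directSumCarrier
    (A : ∀ (F : HodgeCM.CMField) {ι₁ : F →+* ℂ} (V : HodgeCM.HermSpace3 F ι₁), Submodule ℂ ((adelicDatum F V).Adelic → (Fin 2 → ℂ)))
    (hJ : ∀ (hDel : Literature.AlgebraicGeometry.ShimuraVarieties.UnitaryCanonicalModel.canonicalModel_exists_printed)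
      (F : HodgeCM.CMField) [IsGalois ℚ F] (h6 : 6 ≤ Module.finrank ℚ F) {ι₁ : F →+* ℂ} (V : HodgeCM.HermSpace3 F ι₁) (a₀ : RealScalar F)
      (Φ : CMType F) (hΦ : ι₁ ∈ Φ.1) (i : (I V (repAt a₀) (muLiu ι₁ GramClass.rep))),
      3 ≤ (datum413 hDel F V a₀ Φ i).n → ∀ t : (datum413 hDel F V a₀ Φ i).AdmTriple,
        ∃ (H : Type uH) (_ : AddCommGroup H) (_ : Module ℂ H) (τ : Representation ℂ ↥(HodgeCM.HermSpace3.adelicFin V) H)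
          (ι : Type uι) (S : ι → Type uS) (_ : ∀ i, AddCommGroup (S i)) (_ : ∀ i, Module ℂ (S i))
          (σ : ∀ i, Representation ℂ ↥(HodgeCM.HermSpace3.adelicFin V) (S i)) (Ψ : H ≃ₗ[ℂ] ⨁ i, S i)
          (j : H →ₗ[ℂ] ((adelicDatum F V).Adelic → (Fin 2 → ℂ))),
          (∀ (g : ↥(HodgeCM.HermSpace3.adelicFin V)) (x : H) (i : ι), Ψ (τ g x) i = σ i g (Ψ x i)) ∧
            (∀ i, Nontrivial (S i) → (σ i).IsIrreducible) ∧ (∀ i j, Nontrivial (S i) → Nonempty ((σ i).Equiv (σ j)) → i = j) ∧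
            Function.Injective j ∧ (∀ (g : ↥(HodgeCM.HermSpace3.adelicFin V)) (y : H), j (τ g y) = rightRep F V g (j y)) ∧
            (∀ ψ : (datum413 hDel F V a₀ Φ i).omegaAt t →ₗ[ℂ] ((adelicDatum F V).Adelic → (Fin 2 → ℂ)),
              (∀ (g : ↥(HodgeCM.HermSpace3.adelicFin V)) (w : (datum413 hDel F V a₀ Φ i).omegaAt t),
                  ψ ((datum413 hDel F V a₀ Φ i).rhoAt t g w) = rightRep F V g (ψ w)) →
                (∀ w, ψ w ∈ A F V) → ∀ w, ψ w ∈ LinearMap.range j)) :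
    ∀ (hDel : Literature.AlgebraicGeometry.ShimuraVarieties.UnitaryCanonicalModel.canonicalModel_exists_printed)
      (F : HodgeCM.CMField) [IsGalois ℚ F] (h6 : 6 ≤ Module.finrank ℚ F) {ι₁ : F →+* ℂ} (V : HodgeCM.HermSpace3 F ι₁) (a₀ : RealScalar F)
      (Φ : CMType F) (hΦ : ι₁ ∈ Φ.1) (i : (I V (repAt a₀) (muLiu ι₁ GramClass.rep))),
      3 ≤ (datum413 hDel F V a₀ Φ i).n → ∀ t : (datum413 hDel F V a₀ Φ i).AdmTriple,
        ∃ ψ₀ : (datum413 hDel F V a₀ Φ i).omegaAt t →ₗ[ℂ] ((adelicDatum F V).Adelic → (Fin 2 → ℂ)),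
          ∀ ψ : (datum413 hDel F V a₀ Φ i).omegaAt t →ₗ[ℂ] ((adelicDatum F V).Adelic → (Fin 2 → ℂ)),
            (∀ (g : ↥(HodgeCM.HermSpace3.adelicFin V)) (w : (datum413 hDel F V a₀ Φ i).omegaAt t),
                ψ ((datum413 hDel F V a₀ Φ i).rhoAt t g w) = rightRep F V g (ψ w)) →
              (∀ w, ψ w ∈ A F V) → ∃ r : ℂ, ψ = r • ψ₀ := by
  intro hDel F _ h6 ι₁ V a₀ Φ hΦ i hn t
  obtain ⟨H, _, _, τ, ι, S, _, _, σ, Ψ, j, hΨ, hirr, hsep, hj, hjeqv, hA⟩ := hJ hDel F h6 V a₀ Φ hΦ i hn t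
  exact exists_line_rhoAt_datum413_of_directSum_carrier hDel F h6 V a₀ Φ hΦ i t (rightRep F V) (A F V) τ σ Ψ hΨ hirr hsep j hj
    hjeqv hA

set_option synthInstance.maxHeartbeats 400000 in
set_option maxHeartbeats 8000000 in
/-- **MASTER FOLD, IRREDUCIBLE socket** — the carrier is ONE irreducible-or-zero `τ` (after E1′ has collapsed the Matsushima sum to the
`p`-part of the unique `Π` with `Π_f ≅ ω_V(t)`); Schur at the pin supplies the rank bound (★ `rank_intertwiningMap_rhoAt_datum413_le_one_of_irreducible`).
[cite: Rogawski1990, Thm. 14.6.4; §15.3] [cite: Bump1997, Proposition 4.2.4] [cite: Liu2021, proof of Prop. 4.13, l. 2131–2146] -/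
theorem line_of_irreducibleCarrier
    (A : ∀ (F : HodgeCM.CMField) {ι₁ : F →+* ℂ} (V : HodgeCM.HermSpace3 F ι₁), Submodule ℂ ((adelicDatum F V).Adelic → (Fin 2 → ℂ)))
    (hJ : ∀ (hDel : Literature.AlgebraicGeometry.ShimuraVarieties.UnitaryCanonicalModel.canonicalModel_exists_printed)
      (F : HodgeCM.CMField) [IsGalois ℚ F] (h6 : 6 ≤ Module.finrank ℚ F) {ι₁ : F →+* ℂ} (V : HodgeCM.HermSpace3 F ι₁) (a₀ : RealScalar F)
      (Φ : CMType F) (hΦ : ι₁ ∈ Φ.1) (i : (I V (repAt a₀) (muLiu ι₁ GramClass.rep))),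
      3 ≤ (datum413 hDel F V a₀ Φ i).n → ∀ t : (datum413 hDel F V a₀ Φ i).AdmTriple,
        ∃ (Y : Type uY) (_ : AddCommGroup Y) (_ : Module ℂ Y) (τ : Representation ℂ ↥(HodgeCM.HermSpace3.adelicFin V) Y)
          (j : Y →ₗ[ℂ] ((adelicDatum F V).Adelic → (Fin 2 → ℂ))),
          (Nontrivial Y → τ.IsIrreducible) ∧
            Function.Injective j ∧ (∀ (g : ↥(HodgeCM.HermSpace3.adelicFin V)) (y : Y), j (τ g y) = rightRep F V g (j y)) ∧
            (∀ ψ : (datum413 hDel F V a₀ Φ i).omegaAt t →ₗ[ℂ] ((adelicDatum F V).Adelic → (Fin 2 → ℂ)),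
              (∀ (g : ↥(HodgeCM.HermSpace3.adelicFin V)) (w : (datum413 hDel F V a₀ Φ i).omegaAt t),
                  ψ ((datum413 hDel F V a₀ Φ i).rhoAt t g w) = rightRep F V g (ψ w)) →
                (∀ w, ψ w ∈ A F V) → ∀ w, ψ w ∈ LinearMap.range j)) :
    ∀ (hDel : Literature.AlgebraicGeometry.ShimuraVarieties.UnitaryCanonicalModel.canonicalModel_exists_printed)
      (F : HodgeCM.CMField) [IsGalois ℚ F] (h6 : 6 ≤ Module.finrank ℚ F) {ι₁ : F →+* ℂ} (V : HodgeCM.HermSpace3 F ι₁) (a₀ : RealScalar F)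
      (Φ : CMType F) (hΦ : ι₁ ∈ Φ.1) (i : (I V (repAt a₀) (muLiu ι₁ GramClass.rep))),
      3 ≤ (datum413 hDel F V a₀ Φ i).n → ∀ t : (datum413 hDel F V a₀ Φ i).AdmTriple,
        ∃ ψ₀ : (datum413 hDel F V a₀ Φ i).omegaAt t →ₗ[ℂ] ((adelicDatum F V).Adelic → (Fin 2 → ℂ)),
          ∀ ψ : (datum413 hDel F V a₀ Φ i).omegaAt t →ₗ[ℂ] ((adelicDatum F V).Adelic → (Fin 2 → ℂ)),
            (∀ (g : ↥(HodgeCM.HermSpace3.adelicFin V)) (w : (datum413 hDel F V a₀ Φ i).omegaAt t),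
                ψ ((datum413 hDel F V a₀ Φ i).rhoAt t g w) = rightRep F V g (ψ w)) →
              (∀ w, ψ w ∈ A F V) → ∃ r : ℂ, ψ = r • ψ₀ := by
  intro hDel F _ h6 ι₁ V a₀ Φ hΦ i hn t
  obtain ⟨Y, _, _, τ, j, hirr, hj, hjeqv, hA⟩ := hJ hDel F h6 V a₀ Φ hΦ i hn t
  exact exists_line_rhoAt_datum413_of_irreducible_carrier hDel F h6 V a₀ Φ hΦ i t (rightRep F V) (A F V) τ hirr j hj hjeqv hA


/-! ## §2 The folds of the REGISTERED stubs: S3 (`A = holCotForms 𝔞₀`) and S4 (`A = (holCotForms 𝔞₀).map conjFun`), types VERBATIM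
(Lines file v1.1 cf02d7697f46cc99 ll. 201–210 ∕ 217–226, binder for binder) -/

set_option synthInstance.maxHeartbeats 400000 in
set_option maxHeartbeats 8000000 in
/-- **S3 FOLD, RANK socket: `StubS3HolLineAt` from a junction carrier of the holomorphic cotangent forms.**  If at every face with
`3 ≤ n` and every admissible weight-one `t` the equivariant `holCotForms 𝔞₀`-valued maps out of `ω_V(t)` take values in the range of an
equivariant injection `j : τ → (U(V)(𝔸_{F⁺}) → ℂ²)` with `rank_ℂ Hom_{G_f}(ω_V(t), τ) ≤ 1` (junction T7 + letter E1′ at Hodge type `(1,0)`),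
then `StubS3HolLineAt` holds (conclusion = its type verbatim).  By-name closer: `stub_S3_holLineAt := stubS3_of_rankCarrier hJ`.
[cite: Liu2021, proof of Prop. 4.13, l. 2131–2146] [cite: Rogawski1990, Thm. 14.6.4; §15.3] [cite: BorelWallach2000, VII 3.2] -/
theorem stubS3_of_rankCarrier
    (hJ : ∀ (hDel : Literature.AlgebraicGeometry.ShimuraVarieties.UnitaryCanonicalModel.canonicalModel_exists_printed)
      (F : HodgeCM.CMField) [IsGalois ℚ F] (h6 : 6 ≤ Module.finrank ℚ F) {ι₁ : F →+* ℂ} (V : HodgeCM.HermSpace3 F ι₁) (a₀ : RealScalar F)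
      (Φ : CMType F) (hΦ : ι₁ ∈ Φ.1) (i : (I V (repAt a₀) (muLiu ι₁ GramClass.rep))),
      3 ≤ (datum413 hDel F V a₀ Φ i).n → ∀ t : (datum413 hDel F V a₀ Φ i).AdmTriple,
        ∃ (Y : Type uY) (_ : AddCommGroup Y) (_ : Module ℂ Y) (τ : Representation ℂ ↥(HodgeCM.HermSpace3.adelicFin V) Y)
          (j : Y →ₗ[ℂ] ((adelicDatum F V).Adelic → (Fin 2 → ℂ))),
          Function.Injective j ∧ (∀ (g : ↥(HodgeCM.HermSpace3.adelicFin V)) (y : Y), j (τ g y) = rightRep F V g (j y)) ∧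
            (∀ ψ : (datum413 hDel F V a₀ Φ i).omegaAt t →ₗ[ℂ] ((adelicDatum F V).Adelic → (Fin 2 → ℂ)),
              (∀ (g : ↥(HodgeCM.HermSpace3.adelicFin V)) (w : (datum413 hDel F V a₀ Φ i).omegaAt t),
                  ψ ((datum413 hDel F V a₀ Φ i).rhoAt t g w) = rightRep F V g (ψ w)) →
                (∀ w, ψ w ∈ holCotForms (archFactorOf F V)) → ∀ w, ψ w ∈ LinearMap.range j) ∧
            Module.rank ℂ (((datum413 hDel F V a₀ Φ i).rhoAt t).IntertwiningMap τ) ≤ 1) :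
    ∀ (hDel : Literature.AlgebraicGeometry.ShimuraVarieties.UnitaryCanonicalModel.canonicalModel_exists_printed)
      (F : HodgeCM.CMField) [IsGalois ℚ F] (h6 : 6 ≤ Module.finrank ℚ F) {ι₁ : F →+* ℂ} (V : HodgeCM.HermSpace3 F ι₁) (a₀ : RealScalar F)
      (Φ : CMType F) (hΦ : ι₁ ∈ Φ.1) (i : (I V (repAt a₀) (muLiu ι₁ GramClass.rep))),
      3 ≤ (datum413 hDel F V a₀ Φ i).n → ∀ t : (datum413 hDel F V a₀ Φ i).AdmTriple,
        ∃ ψ₀ : (datum413 hDel F V a₀ Φ i).omegaAt t →ₗ[ℂ] ((adelicDatum F V).Adelic → (Fin 2 → ℂ)),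
          ∀ ψ : (datum413 hDel F V a₀ Φ i).omegaAt t →ₗ[ℂ] ((adelicDatum F V).Adelic → (Fin 2 → ℂ)),
            (∀ (g : ↥(HodgeCM.HermSpace3.adelicFin V)) (w : (datum413 hDel F V a₀ Φ i).omegaAt t),
                ψ ((datum413 hDel F V a₀ Φ i).rhoAt t g w) = rightRep F V g (ψ w)) →
              (∀ w, ψ w ∈ holCotForms (archFactorOf F V)) → ∃ r : ℂ, ψ = r • ψ₀ :=
  line_of_rankCarrier.{uY} (fun F _ V => holCotForms (archFactorOf F V)) hJ

set_option synthInstance.maxHeartbeats 400000 in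
set_option maxHeartbeats 8000000 in
/-- **S3 FOLD, MATSUSHIMA socket**: the same with the carrier `τ ≅ ⨁ i, σ i` (`σ i` irreducible-or-zero, pairwise non-isomorphic —
the `(1,0)`-forms `↪ ⨁_Π H^{1,0}-line ⊗ Π_f` over the holomorphic-type discrete `Π`, pairwise non-isomorphy of the `Π_f` being E1′); Schur
at the pin supplies `rank ≤ 1`.  By-name closer: `stub_S3_holLineAt := stubS3_of_directSumCarrier hJ`.
[cite: BorelWallach2000, VII 3.2] [cite: Rogawski1990, Thm. 14.6.4; §15.3] [cite: Bump1997, Proposition 4.2.4] -/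
theorem stubS3_of_directSumCarrier
    (hJ : ∀ (hDel : Literature.AlgebraicGeometry.ShimuraVarieties.UnitaryCanonicalModel.canonicalModel_exists_printed)
      (F : HodgeCM.CMField) [IsGalois ℚ F] (h6 : 6 ≤ Module.finrank ℚ F) {ι₁ : F →+* ℂ} (V : HodgeCM.HermSpace3 F ι₁) (a₀ : RealScalar F)
      (Φ : CMType F) (hΦ : ι₁ ∈ Φ.1) (i : (I V (repAt a₀) (muLiu ι₁ GramClass.rep))),
      3 ≤ (datum413 hDel F V a₀ Φ i).n → ∀ t : (datum413 hDel F V a₀ Φ i).AdmTriple,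
        ∃ (H : Type uH) (_ : AddCommGroup H) (_ : Module ℂ H) (τ : Representation ℂ ↥(HodgeCM.HermSpace3.adelicFin V) H)
          (ι : Type uι) (S : ι → Type uS) (_ : ∀ i, AddCommGroup (S i)) (_ : ∀ i, Module ℂ (S i))
          (σ : ∀ i, Representation ℂ ↥(HodgeCM.HermSpace3.adelicFin V) (S i)) (Ψ : H ≃ₗ[ℂ] ⨁ i, S i)
          (j : H →ₗ[ℂ] ((adelicDatum F V).Adelic → (Fin 2 → ℂ))),
          (∀ (g : ↥(HodgeCM.HermSpace3.adelicFin V)) (x : H) (i : ι), Ψ (τ g x) i = σ i g (Ψ x i)) ∧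
            (∀ i, Nontrivial (S i) → (σ i).IsIrreducible) ∧ (∀ i j, Nontrivial (S i) → Nonempty ((σ i).Equiv (σ j)) → i = j) ∧
            Function.Injective j ∧ (∀ (g : ↥(HodgeCM.HermSpace3.adelicFin V)) (y : H), j (τ g y) = rightRep F V g (j y)) ∧
            (∀ ψ : (datum413 hDel F V a₀ Φ i).omegaAt t →ₗ[ℂ] ((adelicDatum F V).Adelic → (Fin 2 → ℂ)),
              (∀ (g : ↥(HodgeCM.HermSpace3.adelicFin V)) (w : (datum413 hDel F V a₀ Φ i).omegaAt t),
                  ψ ((datum413 hDel F V a₀ Φ i).rhoAt t g w) = rightRep F V g (ψ w)) →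
                (∀ w, ψ w ∈ holCotForms (archFactorOf F V)) → ∀ w, ψ w ∈ LinearMap.range j)) :
    ∀ (hDel : Literature.AlgebraicGeometry.ShimuraVarieties.UnitaryCanonicalModel.canonicalModel_exists_printed)
      (F : HodgeCM.CMField) [IsGalois ℚ F] (h6 : 6 ≤ Module.finrank ℚ F) {ι₁ : F →+* ℂ} (V : HodgeCM.HermSpace3 F ι₁) (a₀ : RealScalar F)
      (Φ : CMType F) (hΦ : ι₁ ∈ Φ.1) (i : (I V (repAt a₀) (muLiu ι₁ GramClass.rep))),
      3 ≤ (datum413 hDel F V a₀ Φ i).n → ∀ t : (datum413 hDel F V a₀ Φ i).AdmTriple,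
        ∃ ψ₀ : (datum413 hDel F V a₀ Φ i).omegaAt t →ₗ[ℂ] ((adelicDatum F V).Adelic → (Fin 2 → ℂ)),
          ∀ ψ : (datum413 hDel F V a₀ Φ i).omegaAt t →ₗ[ℂ] ((adelicDatum F V).Adelic → (Fin 2 → ℂ)),
            (∀ (g : ↥(HodgeCM.HermSpace3.adelicFin V)) (w : (datum413 hDel F V a₀ Φ i).omegaAt t),
                ψ ((datum413 hDel F V a₀ Φ i).rhoAt t g w) = rightRep F V g (ψ w)) →
              (∀ w, ψ w ∈ holCotForms (archFactorOf F V)) → ∃ r : ℂ, ψ = r • ψ₀ :=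
  line_of_directSumCarrier.{uH, uι, uS} (fun F _ V => holCotForms (archFactorOf F V)) hJ

set_option synthInstance.maxHeartbeats 400000 in
set_option maxHeartbeats 8000000 in
/-- **S3 FOLD, IRREDUCIBLE socket**: the same with ONE irreducible-or-zero carrier `τ` (the `(1,0)`-part of the unique holomorphic-type
discrete `Π` with `Π_f ≅ ω_V(t)` — E1′ ∘ J1); Schur at the pin supplies `rank ≤ 1`.  By-name closer:
`stub_S3_holLineAt := stubS3_of_irreducibleCarrier hJ`. [cite: Rogawski1990, Thm. 14.6.4; §15.3] [cite: Bump1997, Proposition 4.2.4]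
[cite: Marshall2014, §4.1] -/
theorem stubS3_of_irreducibleCarrier
    (hJ : ∀ (hDel : Literature.AlgebraicGeometry.ShimuraVarieties.UnitaryCanonicalModel.canonicalModel_exists_printed)
      (F : HodgeCM.CMField) [IsGalois ℚ F] (h6 : 6 ≤ Module.finrank ℚ F) {ι₁ : F →+* ℂ} (V : HodgeCM.HermSpace3 F ι₁) (a₀ : RealScalar F)
      (Φ : CMType F) (hΦ : ι₁ ∈ Φ.1) (i : (I V (repAt a₀) (muLiu ι₁ GramClass.rep))),
      3 ≤ (datum413 hDel F V a₀ Φ i).n → ∀ t : (datum413 hDel F V a₀ Φ i).AdmTriple,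
        ∃ (Y : Type uY) (_ : AddCommGroup Y) (_ : Module ℂ Y) (τ : Representation ℂ ↥(HodgeCM.HermSpace3.adelicFin V) Y)
          (j : Y →ₗ[ℂ] ((adelicDatum F V).Adelic → (Fin 2 → ℂ))),
          (Nontrivial Y → τ.IsIrreducible) ∧
            Function.Injective j ∧ (∀ (g : ↥(HodgeCM.HermSpace3.adelicFin V)) (y : Y), j (τ g y) = rightRep F V g (j y)) ∧
            (∀ ψ : (datum413 hDel F V a₀ Φ i).omegaAt t →ₗ[ℂ] ((adelicDatum F V).Adelic → (Fin 2 → ℂ)),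
              (∀ (g : ↥(HodgeCM.HermSpace3.adelicFin V)) (w : (datum413 hDel F V a₀ Φ i).omegaAt t),
                  ψ ((datum413 hDel F V a₀ Φ i).rhoAt t g w) = rightRep F V g (ψ w)) →
                (∀ w, ψ w ∈ holCotForms (archFactorOf F V)) → ∀ w, ψ w ∈ LinearMap.range j)) :
    ∀ (hDel : Literature.AlgebraicGeometry.ShimuraVarieties.UnitaryCanonicalModel.canonicalModel_exists_printed)
      (F : HodgeCM.CMField) [IsGalois ℚ F] (h6 : 6 ≤ Module.finrank ℚ F) {ι₁ : F →+* ℂ} (V : HodgeCM.HermSpace3 F ι₁) (a₀ : RealScalar F)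
      (Φ : CMType F) (hΦ : ι₁ ∈ Φ.1) (i : (I V (repAt a₀) (muLiu ι₁ GramClass.rep))),
      3 ≤ (datum413 hDel F V a₀ Φ i).n → ∀ t : (datum413 hDel F V a₀ Φ i).AdmTriple,
        ∃ ψ₀ : (datum413 hDel F V a₀ Φ i).omegaAt t →ₗ[ℂ] ((adelicDatum F V).Adelic → (Fin 2 → ℂ)),
          ∀ ψ : (datum413 hDel F V a₀ Φ i).omegaAt t →ₗ[ℂ] ((adelicDatum F V).Adelic → (Fin 2 → ℂ)),
            (∀ (g : ↥(HodgeCM.HermSpace3.adelicFin V)) (w : (datum413 hDel F V a₀ Φ i).omegaAt t),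
                ψ ((datum413 hDel F V a₀ Φ i).rhoAt t g w) = rightRep F V g (ψ w)) →
              (∀ w, ψ w ∈ holCotForms (archFactorOf F V)) → ∃ r : ℂ, ψ = r • ψ₀ :=
  line_of_irreducibleCarrier.{uY} (fun F _ V => holCotForms (archFactorOf F V)) hJ

set_option synthInstance.maxHeartbeats 400000 in
set_option maxHeartbeats 8000000 in
/-- **S4 FOLD, RANK socket: `StubS4AntiholLineAt` from a junction carrier of the ANTIholomorphic cotangent forms `(holCotForms 𝔞₀).map conjFun`**
(junction T7 + letter E1′ at Hodge type `(0,1)`, `cohFinComponentUnique_antihol`); conclusion = the type of `StubS4AntiholLineAt` verbatim.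
By-name closer: `stub_S4_antiholLineAt := stubS4_of_rankCarrier hJ`.
[cite: Liu2021, proof of Prop. 4.13, l. 2131–2146] [cite: Rogawski1990, Thm. 14.6.4; §15.3] [cite: BorelWallach2000, VII 2.10 and 3.2] -/
theorem stubS4_of_rankCarrier
    (hJ : ∀ (hDel : Literature.AlgebraicGeometry.ShimuraVarieties.UnitaryCanonicalModel.canonicalModel_exists_printed)
      (F : HodgeCM.CMField) [IsGalois ℚ F] (h6 : 6 ≤ Module.finrank ℚ F) {ι₁ : F →+* ℂ} (V : HodgeCM.HermSpace3 F ι₁) (a₀ : RealScalar F)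
      (Φ : CMType F) (hΦ : ι₁ ∈ Φ.1) (i : (I V (repAt a₀) (muLiu ι₁ GramClass.rep))),
      3 ≤ (datum413 hDel F V a₀ Φ i).n → ∀ t : (datum413 hDel F V a₀ Φ i).AdmTriple,
        ∃ (Y : Type uY) (_ : AddCommGroup Y) (_ : Module ℂ Y) (τ : Representation ℂ ↥(HodgeCM.HermSpace3.adelicFin V) Y)
          (j : Y →ₗ[ℂ] ((adelicDatum F V).Adelic → (Fin 2 → ℂ))),
          Function.Injective j ∧ (∀ (g : ↥(HodgeCM.HermSpace3.adelicFin V)) (y : Y), j (τ g y) = rightRep F V g (j y)) ∧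
            (∀ ψ : (datum413 hDel F V a₀ Φ i).omegaAt t →ₗ[ℂ] ((adelicDatum F V).Adelic → (Fin 2 → ℂ)),
              (∀ (g : ↥(HodgeCM.HermSpace3.adelicFin V)) (w : (datum413 hDel F V a₀ Φ i).omegaAt t),
                  ψ ((datum413 hDel F V a₀ Φ i).rhoAt t g w) = rightRep F V g (ψ w)) →
                (∀ w, ψ w ∈ (holCotForms (archFactorOf F V)).map (conjFun F V)) → ∀ w, ψ w ∈ LinearMap.range j) ∧
            Module.rank ℂ (((datum413 hDel F V a₀ Φ i).rhoAt t).IntertwiningMap τ) ≤ 1) :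
    ∀ (hDel : Literature.AlgebraicGeometry.ShimuraVarieties.UnitaryCanonicalModel.canonicalModel_exists_printed)
      (F : HodgeCM.CMField) [IsGalois ℚ F] (h6 : 6 ≤ Module.finrank ℚ F) {ι₁ : F →+* ℂ} (V : HodgeCM.HermSpace3 F ι₁) (a₀ : RealScalar F)
      (Φ : CMType F) (hΦ : ι₁ ∈ Φ.1) (i : (I V (repAt a₀) (muLiu ι₁ GramClass.rep))),
      3 ≤ (datum413 hDel F V a₀ Φ i).n → ∀ t : (datum413 hDel F V a₀ Φ i).AdmTriple,
        ∃ ψ₀ : (datum413 hDel F V a₀ Φ i).omegaAt t →ₗ[ℂ] ((adelicDatum F V).Adelic → (Fin 2 → ℂ)),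
          ∀ ψ : (datum413 hDel F V a₀ Φ i).omegaAt t →ₗ[ℂ] ((adelicDatum F V).Adelic → (Fin 2 → ℂ)),
            (∀ (g : ↥(HodgeCM.HermSpace3.adelicFin V)) (w : (datum413 hDel F V a₀ Φ i).omegaAt t),
                ψ ((datum413 hDel F V a₀ Φ i).rhoAt t g w) = rightRep F V g (ψ w)) →
              (∀ w, ψ w ∈ (holCotForms (archFactorOf F V)).map (conjFun F V)) → ∃ r : ℂ, ψ = r • ψ₀ :=
  line_of_rankCarrier.{uY} (fun F _ V => (holCotForms (archFactorOf F V)).map (conjFun F V)) hJ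

set_option synthInstance.maxHeartbeats 400000 in
set_option maxHeartbeats 8000000 in
/-- **S4 FOLD, MATSUSHIMA socket** (carrier `≅ ⨁ i, σ i`, `σ i` irreducible-or-zero pairwise non-isomorphic; Schur at the pin).
By-name closer: `stub_S4_antiholLineAt := stubS4_of_directSumCarrier hJ`.
[cite: BorelWallach2000, VII 2.10 and 3.2] [cite: Rogawski1990, Thm. 14.6.4; §15.3] [cite: Bump1997, Proposition 4.2.4] -/
theorem stubS4_of_directSumCarrier
    (hJ : ∀ (hDel : Literature.AlgebraicGeometry.ShimuraVarieties.UnitaryCanonicalModel.canonicalModel_exists_printed)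
      (F : HodgeCM.CMField) [IsGalois ℚ F] (h6 : 6 ≤ Module.finrank ℚ F) {ι₁ : F →+* ℂ} (V : HodgeCM.HermSpace3 F ι₁) (a₀ : RealScalar F)
      (Φ : CMType F) (hΦ : ι₁ ∈ Φ.1) (i : (I V (repAt a₀) (muLiu ι₁ GramClass.rep))),
      3 ≤ (datum413 hDel F V a₀ Φ i).n → ∀ t : (datum413 hDel F V a₀ Φ i).AdmTriple,
        ∃ (H : Type uH) (_ : AddCommGroup H) (_ : Module ℂ H) (τ : Representation ℂ ↥(HodgeCM.HermSpace3.adelicFin V) H)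
          (ι : Type uι) (S : ι → Type uS) (_ : ∀ i, AddCommGroup (S i)) (_ : ∀ i, Module ℂ (S i))
          (σ : ∀ i, Representation ℂ ↥(HodgeCM.HermSpace3.adelicFin V) (S i)) (Ψ : H ≃ₗ[ℂ] ⨁ i, S i)
          (j : H →ₗ[ℂ] ((adelicDatum F V).Adelic → (Fin 2 → ℂ))),
          (∀ (g : ↥(HodgeCM.HermSpace3.adelicFin V)) (x : H) (i : ι), Ψ (τ g x) i = σ i g (Ψ x i)) ∧
            (∀ i, Nontrivial (S i) → (σ i).IsIrreducible) ∧ (∀ i j, Nontrivial (S i) → Nonempty ((σ i).Equiv (σ j)) → i = j) ∧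
            Function.Injective j ∧ (∀ (g : ↥(HodgeCM.HermSpace3.adelicFin V)) (y : H), j (τ g y) = rightRep F V g (j y)) ∧
            (∀ ψ : (datum413 hDel F V a₀ Φ i).omegaAt t →ₗ[ℂ] ((adelicDatum F V).Adelic → (Fin 2 → ℂ)),
              (∀ (g : ↥(HodgeCM.HermSpace3.adelicFin V)) (w : (datum413 hDel F V a₀ Φ i).omegaAt t),
                  ψ ((datum413 hDel F V a₀ Φ i).rhoAt t g w) = rightRep F V g (ψ w)) →
                (∀ w, ψ w ∈ (holCotForms (archFactorOf F V)).map (conjFun F V)) → ∀ w, ψ w ∈ LinearMap.range j)) :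
    ∀ (hDel : Literature.AlgebraicGeometry.ShimuraVarieties.UnitaryCanonicalModel.canonicalModel_exists_printed)
      (F : HodgeCM.CMField) [IsGalois ℚ F] (h6 : 6 ≤ Module.finrank ℚ F) {ι₁ : F →+* ℂ} (V : HodgeCM.HermSpace3 F ι₁) (a₀ : RealScalar F)
      (Φ : CMType F) (hΦ : ι₁ ∈ Φ.1) (i : (I V (repAt a₀) (muLiu ι₁ GramClass.rep))),
      3 ≤ (datum413 hDel F V a₀ Φ i).n → ∀ t : (datum413 hDel F V a₀ Φ i).AdmTriple,
        ∃ ψ₀ : (datum413 hDel F V a₀ Φ i).omegaAt t →ₗ[ℂ] ((adelicDatum F V).Adelic → (Fin 2 → ℂ)),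
          ∀ ψ : (datum413 hDel F V a₀ Φ i).omegaAt t →ₗ[ℂ] ((adelicDatum F V).Adelic → (Fin 2 → ℂ)),
            (∀ (g : ↥(HodgeCM.HermSpace3.adelicFin V)) (w : (datum413 hDel F V a₀ Φ i).omegaAt t),
                ψ ((datum413 hDel F V a₀ Φ i).rhoAt t g w) = rightRep F V g (ψ w)) →
              (∀ w, ψ w ∈ (holCotForms (archFactorOf F V)).map (conjFun F V)) → ∃ r : ℂ, ψ = r • ψ₀ :=
  line_of_directSumCarrier.{uH, uι, uS} (fun F _ V => (holCotForms (archFactorOf F V)).map (conjFun F V)) hJ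

set_option synthInstance.maxHeartbeats 400000 in
set_option maxHeartbeats 8000000 in
/-- **S4 FOLD, IRREDUCIBLE socket** (ONE irreducible-or-zero carrier: the `(0,1)`-part of the unique antiholomorphic-type `Π` with
`Π_f ≅ ω_V(t)`; Schur at the pin).  By-name closer: `stub_S4_antiholLineAt := stubS4_of_irreducibleCarrier hJ`.
[cite: Rogawski1990, Thm. 14.6.4; §15.3] [cite: Bump1997, Proposition 4.2.4] [cite: Marshall2014, §4.1] -/
theorem stubS4_of_irreducibleCarrier
    (hJ : ∀ (hDel : Literature.AlgebraicGeometry.ShimuraVarieties.UnitaryCanonicalModel.canonicalModel_exists_printed)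
      (F : HodgeCM.CMField) [IsGalois ℚ F] (h6 : 6 ≤ Module.finrank ℚ F) {ι₁ : F →+* ℂ} (V : HodgeCM.HermSpace3 F ι₁) (a₀ : RealScalar F)
      (Φ : CMType F) (hΦ : ι₁ ∈ Φ.1) (i : (I V (repAt a₀) (muLiu ι₁ GramClass.rep))),
      3 ≤ (datum413 hDel F V a₀ Φ i).n → ∀ t : (datum413 hDel F V a₀ Φ i).AdmTriple,
        ∃ (Y : Type uY) (_ : AddCommGroup Y) (_ : Module ℂ Y) (τ : Representation ℂ ↥(HodgeCM.HermSpace3.adelicFin V) Y)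
          (j : Y →ₗ[ℂ] ((adelicDatum F V).Adelic → (Fin 2 → ℂ))),
          (Nontrivial Y → τ.IsIrreducible) ∧
            Function.Injective j ∧ (∀ (g : ↥(HodgeCM.HermSpace3.adelicFin V)) (y : Y), j (τ g y) = rightRep F V g (j y)) ∧
            (∀ ψ : (datum413 hDel F V a₀ Φ i).omegaAt t →ₗ[ℂ] ((adelicDatum F V).Adelic → (Fin 2 → ℂ)),
              (∀ (g : ↥(HodgeCM.HermSpace3.adelicFin V)) (w : (datum413 hDel F V a₀ Φ i).omegaAt t),
                  ψ ((datum413 hDel F V a₀ Φ i).rhoAt t g w) = rightRep F V g (ψ w)) →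
                (∀ w, ψ w ∈ (holCotForms (archFactorOf F V)).map (conjFun F V)) → ∀ w, ψ w ∈ LinearMap.range j)) :
    ∀ (hDel : Literature.AlgebraicGeometry.ShimuraVarieties.UnitaryCanonicalModel.canonicalModel_exists_printed)
      (F : HodgeCM.CMField) [IsGalois ℚ F] (h6 : 6 ≤ Module.finrank ℚ F) {ι₁ : F →+* ℂ} (V : HodgeCM.HermSpace3 F ι₁) (a₀ : RealScalar F)
      (Φ : CMType F) (hΦ : ι₁ ∈ Φ.1) (i : (I V (repAt a₀) (muLiu ι₁ GramClass.rep))),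
      3 ≤ (datum413 hDel F V a₀ Φ i).n → ∀ t : (datum413 hDel F V a₀ Φ i).AdmTriple,
        ∃ ψ₀ : (datum413 hDel F V a₀ Φ i).omegaAt t →ₗ[ℂ] ((adelicDatum F V).Adelic → (Fin 2 → ℂ)),
          ∀ ψ : (datum413 hDel F V a₀ Φ i).omegaAt t →ₗ[ℂ] ((adelicDatum F V).Adelic → (Fin 2 → ℂ)),
            (∀ (g : ↥(HodgeCM.HermSpace3.adelicFin V)) (w : (datum413 hDel F V a₀ Φ i).omegaAt t),
                ψ ((datum413 hDel F V a₀ Φ i).rhoAt t g w) = rightRep F V g (ψ w)) →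
              (∀ w, ψ w ∈ (holCotForms (archFactorOf F V)).map (conjFun F V)) → ∃ r : ℂ, ψ = r • ψ₀ :=
  line_of_irreducibleCarrier.{uY} (fun F _ V => (holCotForms (archFactorOf F V)).map (conjFun F V)) hJ

end Summit.HodgeConjecture.HodgeConjecture.Cruxes.H413.F0P3HolLineFolds

end
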